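import Mathlib
import Literature.NumberTheory.Sieve.Maynard2016CoupledEulerW
import Literature.NumberTheory.Sieve.Maynard2016CoupledKernel
import HarnessLib

/-!
# Maynard (2016), Lemma 7: the weighted coupled kernel over a finite set of primes

Topic `Literature/NumberTheory/Sieve`; trunk AntSieve / parity (Maynard 2016 large-gaps ladder, named
fact `Literature.NumberTheory.Sieve.Maynard2016.Lemma7Tuple` of `Maynard2016Lemma7PerTuple.lean`).

J. Maynard, *Large gaps between primes*, Ann. of Math. (2) 183 (2016), 915–933 = arXiv:1408.5110,
§6, displays (6.10)–(6.13) (Lemma 6) and (6.32) (Lemma 7).  `Maynard2016CoupledKernel` proves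
"(6.10) = `∏_p K_p`" over a finite set of primes for the Möbius–power weights and the denominator
`[d,d',e,e']` (`sum_pairBox_coupledEulerTerm`); here the same is done for the GENERAL multiplicative
denominator weight `w` of `Maynard2016CoupledEulerW` (Lemma 7 uses `w = 1/φ`):
`coupledEulerTermW`, `coupledLocalFactorMuW`, **`sum_pairBox_coupledEulerTermW`**, and the
domination `norm_coupledSummandW_le` of the weighted summand by the unweighted one with doubled
absolute numerators when `|w(p)| ≤ 2/p` (`IsLcmWeight`), which is what carries the absolute-convergence
layer of `Maynard2016CoupledKernel` over to the weighted kernel.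

## References

* J. Maynard, *Large gaps between primes*, Ann. of Math. (2) 183 (2016), 915–933; arXiv:1408.5110,
  §6, displays (6.10)–(6.13) and (6.32). [Maynard2016LargeGaps]
* D. H. J. Polymath, *Variants of the Selberg sieve, and bounded intervals containing many primes*,
  Res. Math. Sci. 1 (2014), Lemma 4.1 (last paragraph of the proof). [Polymath8b2014]
-/

noncomputable section

open Finset ArithmeticFunction
open scoped BigOperators Classical

namespace Literature.NumberTheory.Sieve

namespace LcmEuler

variable {ι κ : Type*} [Fintype ι] [DecidableEq ι] [Fintype κ] [DecidableEq κ]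

/-! ### The weighted terms -/

/-- The term of the weighted coupled kernel:
`[CoupledAdm] ∏_i μ(d_i)μ(d'_i) d_i^{-a_i} (d'_i)^{-b_i} ∏_j μ(e_j)μ(e'_j) e_j^{-a'_j} (e'_j)^{-b'_j} · w([d,d',e,e'])`.
[cite: Maynard2016LargeGaps, §6 displays (6.10), (6.32)] -/
def coupledEulerTermW (w : ℕ → ℂ) (W m : ℕ) (M : ℕ → Finset (ι × κ)) (a b : ι → ℂ)
    (a' b' : κ → ℂ) (t : ((ι → ℕ) × (ι → ℕ)) × ((κ → ℕ) × (κ → ℕ))) : ℂ :=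
  if CoupledAdm W m M t.1 t.2 then
    coupledSummandW (moebiusWeight a) (moebiusWeight b) (moebiusWeight a') (moebiusWeight b') w
      t.1 t.2
  else 0

/-- The weighted coupled kernel, as a sum over all pairs of pairs of tuples. [cite: Maynard2016LargeGaps, §6 displays (6.10), (6.32)] -/
def coupledKernelW (w : ℕ → ℂ) (W m : ℕ) (M : ℕ → Finset (ι × κ)) (a b : ι → ℂ) (a' b' : κ → ℂ) :
    ℂ :=
  ∑' t, coupledEulerTermW w W m M a b a' b' t

/-- The weighted Euler factor `K^w_p` for the Möbius–power weights. [cite: Maynard2016LargeGaps, §6 displays (6.11)–(6.13), (6.32)] -/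
def coupledLocalFactorMuW (w : ℕ → ℂ) (m : ℕ) (M : ℕ → Finset (ι × κ)) (a b : ι → ℂ)
    (a' b' : κ → ℂ) (q : ℕ) : ℂ :=
  coupledLocalFactorW (moebiusWeight a) (moebiusWeight b) (moebiusWeight a') (moebiusWeight b') w m M q

omit [Fintype ι] [DecidableEq ι] [Fintype κ] [DecidableEq κ] in
/-- `w = 1/n` recovers `coupledEulerTerm`. [cite: Maynard2016LargeGaps, §6 display (6.10)] -/
theorem coupledEulerTermW_inv [Fintype ι] [Fintype κ] (W m : ℕ) (M : ℕ → Finset (ι × κ))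
    (a b : ι → ℂ) (a' b' : κ → ℂ) (t : ((ι → ℕ) × (ι → ℕ)) × ((κ → ℕ) × (κ → ℕ))) :
    coupledEulerTermW (fun n => (n : ℂ)⁻¹) W m M a b a' b' t = coupledEulerTerm W m M a b a' b' t := by
  unfold coupledEulerTermW coupledEulerTerm
  rw [coupledSummandW_inv]

/-! ### The finite Euler product over pairs supported on `P` -/

omit [Fintype ι] [Fintype κ] in
/-- On pairs supported on primes of `P` not dividing `W`, `CoupledAdm` is pairwise coprimality on both
sides together with the finite cross condition `CrossCond P`. [folklore] -/
private theorem coupledAdm_iff_of_mem_pairBox' [Fintype ι] [Fintype κ] {P : Finset ℕ}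
    (hP : ∀ q ∈ P, q.Prime) {W : ℕ} (hPW : ∀ q ∈ P, ¬ q ∣ W) (m : ℕ) (M : ℕ → Finset (ι × κ))
    {tD : (ι → ℕ) × (ι → ℕ)} {tE : (κ → ℕ) × (κ → ℕ)} (htD : tD ∈ pairBox ι P)
    (htE : tE ∈ pairBox κ P) :
    CoupledAdm W m M tD tE ↔
      PairwiseCoprimeLcm tD ∧ PairwiseCoprimeLcm tE ∧ CrossCond P m M tD tE := by
  rw [CoupledAdm, lcmCoprime_iff_of_mem_pairBox hP hPW htD, lcmCoprime_iff_of_mem_pairBox hP hPW htE,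
    CrossCond]
  have hmem := htD
  simp only [pairBox, Finset.mem_product, Fintype.mem_piFinset, Nat.mem_divisors] at hmem
  constructor
  · rintro ⟨h1, h2, h3, h4⟩
    exact ⟨h1, h2, h3, fun q hq i j hdi hej => h4 q (hP q hq) i j hdi hej⟩
  · rintro ⟨h1, h2, h3, h4⟩
    refine ⟨h1, h2, h3, fun p hp i j hdi hej => h4 p ?_ i j hdi hej⟩
    have hdvd : p ∣ ∏ q ∈ P, q := hdi.trans (Nat.lcm_dvd (hmem.1 i).1 (hmem.2 i).1)
    obtain ⟨q, hq, hpq⟩ := (hp.prime.dvd_finsetProd_iff _).1 hdvd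
    rwa [(Nat.prime_dvd_prime_iff_eq hp (hP q hq)).1 hpq]

/-- **The weighted (6.10) = `∏_p K^w_p` over a finite set of primes**: for a finite set `P` of primes
not dividing `W` and a weight `w` multiplicative over products of distinct primes, the sum of the
weighted coupled terms over the pairs supported on `P` is `∏_{p ∈ P} K^w_p`.
[cite: Maynard2016LargeGaps, §6 displays (6.10)–(6.13), (6.32)] -/
theorem sum_pairBox_coupledEulerTermW {P : Finset ℕ} (hP : ∀ q ∈ P, q.Prime) {W : ℕ}
    (hPW : ∀ q ∈ P, ¬ q ∣ W) {w : ℕ → ℂ} (hw : IsPrimeProdMult w) (m : ℕ) (M : ℕ → Finset (ι × κ))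
    (a b : ι → ℂ) (a' b' : κ → ℂ) :
    ∑ tD ∈ pairBox ι P, ∑ tE ∈ pairBox κ P, coupledEulerTermW w W m M a b a' b' (tD, tE) =
      ∏ q ∈ P, coupledLocalFactorMuW w m M a b a' b' q := by
  have h1 : ∑ tD ∈ pairBox ι P, ∑ tE ∈ pairBox κ P, coupledEulerTermW w W m M a b a' b' (tD, tE) =
      ∑ tD ∈ pairBox ι P, ∑ tE ∈ pairBox κ P,
        (if PairwiseCoprimeLcm tD then
          (if PairwiseCoprimeLcm tE then
            (if CrossCond P m M tD tE then
              coupledSummandW (moebiusWeight a) (moebiusWeight b) (moebiusWeight a')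
                (moebiusWeight b') w tD tE else 0) else 0) else 0) := by
    refine Finset.sum_congr rfl fun tD htD => Finset.sum_congr rfl fun tE htE => ?_
    rw [coupledEulerTermW]
    simp only
    rw [if_congr (coupledAdm_iff_of_mem_pairBox' hP hPW m M htD htE) rfl rfl]
    by_cases hD : PairwiseCoprimeLcm tD <;> by_cases hE : PairwiseCoprimeLcm tE <;>
      by_cases hC : CrossCond P m M tD tE <;> simp [hD, hE, hC]
  rw [h1]
  have h2 : ∀ tD ∈ pairBox ι P, ∑ tE ∈ pairBox κ P,
      (if PairwiseCoprimeLcm tD then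
        (if PairwiseCoprimeLcm tE then
          (if CrossCond P m M tD tE then
            coupledSummandW (moebiusWeight a) (moebiusWeight b) (moebiusWeight a')
              (moebiusWeight b') w tD tE else 0) else 0) else 0) =
      if PairwiseCoprimeLcm tD then ∑ tE ∈ (pairBox κ P).filter PairwiseCoprimeLcm,
        (if CrossCond P m M tD tE then
          coupledSummandW (moebiusWeight a) (moebiusWeight b) (moebiusWeight a')
            (moebiusWeight b') w tD tE else 0) else 0 := by
    intro tD _
    split_ifs with hD
    · rw [Finset.sum_filter]
    · simp
  rw [Finset.sum_congr rfl h2, ← Finset.sum_filter]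
  exact sum_coupledW_eq_prod hP _ _ _ _ (fun i => isPrimeProdMult_moebius_cpow (a i))
    (fun i => isPrimeProdMult_moebius_cpow (b i)) (fun j => isPrimeProdMult_moebius_cpow (a' j))
    (fun j => isPrimeProdMult_moebius_cpow (b' j)) hw m M

/-! ### Domination of the weighted summand -/

/-- **Domination**: if `|w(n)| ≤ 2^{ω(n)}/n` on squarefree `n` — in particular for an `IsLcmWeight`
(`|w(p)| ≤ 2/p`) — then on coupled-admissible tuples (all `[d_i,d'_i]`, `[e_j,e'_j]` squarefree and
pairwise coprime) `|coupledSummandW g h g' h' w| ≤ coupledSummand (2|g|) (2|h|) (2|g'|) (2|h'|)`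
evaluated with absolute values: each prime of `[d,d',e,e']` occurs in at least one slot.  Stated in the
elementary form `‖N · w(L)‖ ≤ ‖N‖ · 2^{ω(L)}/L` used downstream. [cite: Polymath8b2014, Lemma 4.1 (last paragraph of the proof)] -/
theorem norm_mul_weight_le {w : ℕ → ℂ} (hw : IsLcmWeight w) {L : ℕ} (hL : Squarefree L) (N : ℂ) :
    ‖N * w L‖ ≤ ‖N‖ * ((2 : ℝ) ^ L.primeFactors.card / L) := by
  rw [norm_mul]
  refine mul_le_mul_of_nonneg_left ?_ (norm_nonneg _)
  have hL0 : L ≠ 0 := hL.ne_zero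
  have hLeq : L = ∏ p ∈ L.primeFactors, p := (Nat.prod_primeFactors_of_squarefree hL).symm
  have hprime : ∀ p ∈ L.primeFactors, p.Prime := fun p hp => Nat.prime_of_mem_primeFactors hp
  have h1 : w L = ∏ p ∈ L.primeFactors, w p := by
    conv_lhs => rw [hLeq]
    exact hw.mult _ hprime
  rw [h1, norm_prod]
  have h2 : ((2 : ℝ) ^ L.primeFactors.card / L) = ∏ p ∈ L.primeFactors, (2 : ℝ) / p := by
    rw [Finset.prod_div_distrib, Finset.prod_const]
    congr 1
    conv_lhs => rw [hLeq]
    push_cast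
    rfl
  rw [h2]
  exact Finset.prod_le_prod (fun p _ => norm_nonneg _) fun p hp => hw.norm_le p (hprime p hp)

end LcmEuler

end Literature.NumberTheory.Sieve

end
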